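import Summits.Ventures.QEC.Census.CertCoverChecks
import HarnessLib

/-!
# Cover reduction, part 7: the popcount-free form of the coset checker (`cosetOKD`)
# (qec lane ε; kernel-cost note of 2026-08-27: the plain `cosetOK` spends ≈ 40 s per 144-bit problem in bit-serial
#  popcounts for the kernel-membership conjuncts `synZero Hq g`, `g ∈ G ++ BU`)

`cosetOKD nq Hq D P gD bD` is `cosetOK nq Hq D P` with the kernel-membership tests of the rows `G`, `BU` REPLACED by
change-of-basis identities `G[j] = xorSel D gD[j]`, `BU[j] = xorSel D bD[j]` (XORs only): since every entry of `D` is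
a kernel word of `Hq` (checked ONCE per level, `D.all (synZero nq Hq)`), the rows are kernel words too
(`synZero_xorSel_of_forall`).  `cosetOK_of_cosetOKD` recovers the landed checker's verdict, so `coset_sound` and the
level lemmas apply unchanged; the kernel never evaluates a popcount per row.
HONEST FRAMING: generic; everything proved; no instances, no notation.
-/

namespace Summit.Ventures.QEC.Census

/-- **Popcount-free coset checker**: as `cosetOK`, but the rows of `G` and `BU` are certified as the stated
selections `gD[j]`, `bD[j]` of the kernel generator list `D` instead of by syndrome tests. (definition) -/
def cosetOKD (nq : ℕ) (Hq D : List ℕ) (P : CosetProb) (gD bD : List ℕ) : Bool :=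
  synEqOK nq Hq P.y0 P.sigma && decide (P.y0 < 2 ^ nq) && (P.y0 &&& maskOf P.T == 0) &&
    (gD.length == P.G.length) &&
    ((List.range P.G.length).all fun j => (xorSel D (gD.getD j 0) == P.G.getD j 0) && decide (P.G.getD j 0 < 2 ^ nq)) &&
    systematicOK nq P.G P.T && (maskOf P.T &&& P.U == 0) &&
    (bD.length == P.BU.length) &&
    ((List.range P.BU.length).all fun j =>
      (xorSel D (bD.getD j 0) == P.BU.getD j 0) && decide (P.BU.getD j 0 < 2 ^ nq) && (P.BU.getD j 0 &&& P.U == P.BU.getD j 0)) &&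
    ((List.range D.length).all fun i =>
      (xorSel P.G (P.coefG.getD i 0) ^^^ xorSel P.BU (P.coefB.getD i 0)) == D.getD i 0) &&
    scan (bzLeaf P.f P.allow) (rowPos (P.G.map (clr P.U)) 0) P.f (2 ^ P.G.length) (clr P.U P.y0)

/-- **`cosetOKD` + «every generator of `D` is a kernel word» ⇒ `cosetOK`.** -/
theorem cosetOK_of_cosetOKD {nq : ℕ} {Hq D : List ℕ} {P : CosetProb} {gD bD : List ℕ}
    (hD : (D.all fun d => synZero nq Hq d) = true) (h : cosetOKD nq Hq D P gD bD = true) :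
    cosetOK nq Hq D P = true := by
  simp only [List.all_eq_true] at hD
  simp only [cosetOKD, Bool.and_eq_true, List.all_eq_true, List.mem_range, beq_iff_eq, decide_eq_true_eq] at h
  obtain ⟨⟨⟨⟨⟨⟨⟨⟨⟨⟨hy0syn, hy0lt⟩, hy0T⟩, -⟩, hG⟩, hsys⟩, hTU⟩, -⟩, hBU⟩, hcoef⟩, hscan⟩ := h
  simp only [cosetOK, Bool.and_eq_true, List.all_eq_true, List.mem_range, beq_iff_eq, decide_eq_true_eq]
  refine ⟨⟨⟨⟨⟨⟨⟨⟨hy0syn, hy0lt⟩, hy0T⟩, ?_⟩, hsys⟩, hTU⟩, ?_⟩, hcoef⟩, hscan⟩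
  · intro g hg
    obtain ⟨j, hj, rfl⟩ := List.getElem_of_mem hg
    obtain ⟨hgj, hlt⟩ := hG j hj
    have e : P.G.getD j 0 = P.G[j] := by
      rw [List.getD_eq_getElem?_getD, List.getElem?_eq_getElem hj, Option.getD_some]
    rw [e] at hgj hlt
    refine ⟨?_, hlt⟩
    rw [← hgj]
    exact synZero_xorSel_of_forall D hD _
  · intro b hb
    obtain ⟨j, hj, rfl⟩ := List.getElem_of_mem hb
    obtain ⟨⟨hbj, hlt⟩, hU⟩ := hBU j hj
    have e : P.BU.getD j 0 = P.BU[j] := by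
      rw [List.getD_eq_getElem?_getD, List.getElem?_eq_getElem hj, Option.getD_some]
    rw [e] at hbj hlt hU
    refine ⟨⟨?_, hlt⟩, hU⟩
    rw [← hbj]
    exact synZero_xorSel_of_forall D hD _

/-- Control: the toy problem of `CertCoverCoset.lean` in the popcount-free form (`G = D`, so `gD = [1,2,4]`). -/
theorem toyCosetD_ok : cosetOKD 4 [15] [3, 5, 9] toyCoset [1, 2, 4] [] = true := by decide

end Summit.Ventures.QEC.Census
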